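import Mathlib.RingTheory.Polynomial.Cyclotomic.Factorization
import Summits.QuantumAdvantage.QuantumAdvantage.Theorems.SymplecticPurityDefs

/-!
# Route `SymplecticPurity`, item `NoFreeFrame` — `Φ_{3^{k+1}}` is irreducible over `𝔽₂`

The good input lengths of the witness family are `n = 2·3^k`, where the modulus
`X^{2·3^k} + X^{3^k} + 1 = Φ_{3^{k+1}}` of its arithmetic is irreducible over `𝔽₂`
(Lidl–Niederreiter, *Finite Fields*, Thm. 2.47(ii) with Ex. 2.48: `Φ_m` is irreducible over `𝔽_q`
iff `q` is a primitive root mod `m`; and `2` is a primitive root modulo every power of `3`). In Mathlib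
terms (`ZMod.irreducible_of_dvd_cyclotomic_of_natDegree`) this is the computation
`ord_{3^{k+1}}(2) = 2·3^k`, done here by hand: `2^{3^k} ≡ 2 (mod 3)` excludes the divisor `3^k` of
the order, and the lifting-the-exponent congruence `4^{3^j} = 1 + 3^{j+1}·t`, `3 ∤ t`, excludes
`2·3^{k-1}`. Consequences: `AdjoinRoot (cubePoly k)` is a field with `2^{2·3^k}` elements.
-/

noncomputable section

set_option linter.dupNamespace false -- D-0017: single-problem summit ⇒ `QuantumAdvantage.QuantumAdvantage` by design

namespace Summit.QuantumAdvantage.QuantumAdvantage.Theorems.SymplecticPurity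

open Polynomial

/-! ### `ord_{3^{k+1}}(2) = 2·3^k` -/

/-- Lifting the exponent at `3`: `4^{3^j} = 1 + 3^{j+1} t` with `3 ∤ t`. -/
theorem four_pow_three_pow (j : ℕ) : ∃ t : ℕ, 4 ^ 3 ^ j = 1 + 3 ^ (j + 1) * t ∧ ¬ 3 ∣ t := by
  induction j with
  | zero => exact ⟨1, by norm_num, by norm_num⟩
  | succ j ih =>
    obtain ⟨t, ht, h3⟩ := ih
    refine ⟨t + 3 * (3 ^ j * t ^ 2 + 3 ^ (2 * j) * t ^ 3), ?_, ?_⟩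
    · rw [pow_succ, pow_mul, ht]; ring
    · omega

/-- `3^{k+1} ∤ 4^{3^{k-1}} − 1` for `k ≥ 1`. -/
theorem not_dvd_four_pow_sub_one {k : ℕ} (hk : 1 ≤ k) : ¬ 3 ^ (k + 1) ∣ 4 ^ 3 ^ (k - 1) - 1 := by
  obtain ⟨t, ht, h3⟩ := four_pow_three_pow (k - 1)
  rw [ht, Nat.add_sub_cancel_left, show k - 1 + 1 = k by omega]
  rintro ⟨c, hc⟩
  apply h3
  refine ⟨c, ?_⟩
  have h3k : 0 < 3 ^ k := pow_pos (by norm_num) k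
  rw [pow_succ, mul_assoc] at hc
  exact Nat.eq_of_mul_eq_mul_left h3k hc

/-- `2` is coprime to `3^{k+1}`. -/
theorem coprime_two_three_pow (k : ℕ) : Nat.Coprime 2 (3 ^ (k + 1)) :=
  Nat.Coprime.pow_right _ (by norm_num)

/-- `2^{3^k} ≠ 1` in `ZMod 3^{k+1}` (it is `≡ 2 mod 3`). -/
theorem two_pow_three_pow_ne_one (k : ℕ) : ((2 : ℕ) : ZMod (3 ^ (k + 1))) ^ 3 ^ k ≠ 1 := by
  intro h
  have h3 : 3 ∣ 3 ^ (k + 1) := dvd_pow_self 3 (Nat.succ_ne_zero k)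
  have hc := congrArg (ZMod.castHom h3 (ZMod 3)) h
  rw [map_pow, map_natCast, map_one] at hc
  -- in `ZMod 3`: `2 ^ 3^k = 2`
  have hodd : Odd (3 ^ k) := Odd.pow (by decide)
  obtain ⟨m, hm⟩ := hodd
  rw [hm, pow_succ, pow_mul] at hc
  have h4 : ((2 : ℕ) : ZMod 3) ^ 2 = 1 := by decide
  rw [h4, one_pow, one_mul] at hc
  exact absurd hc (by decide)

/-- `2^{2·3^{k-1}} ≠ 1` in `ZMod 3^{k+1}` for `k ≥ 1` (lifting the exponent). -/
theorem two_pow_two_mul_three_pow_ne_one {k : ℕ} (hk : 1 ≤ k) :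
    ((2 : ℕ) : ZMod (3 ^ (k + 1))) ^ (2 * 3 ^ (k - 1)) ≠ 1 := by
  intro h
  have h' : ((4 ^ 3 ^ (k - 1) : ℕ) : ZMod (3 ^ (k + 1))) = ((1 : ℕ) : ZMod (3 ^ (k + 1))) := by
    rw [show (4 : ℕ) = 2 ^ 2 by norm_num, ← pow_mul, Nat.cast_pow, Nat.cast_one]; exact h
  rw [ZMod.natCast_eq_natCast_iff, Nat.ModEq.comm,
    Nat.modEq_iff_dvd' (Nat.one_le_pow _ _ (by norm_num))] at h'
  exact not_dvd_four_pow_sub_one hk h'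

/-- **`2` is a primitive root modulo `3^{k+1}`**: `ord_{3^{k+1}}(2) = 2·3^k = φ(3^{k+1})`. -/
theorem orderOf_two_mod_three_pow (k : ℕ) :
    orderOf (ZMod.unitOfCoprime 2 (coprime_two_three_pow k)) = 2 * 3 ^ k := by
  have hne : NeZero (3 ^ (k + 1)) := ⟨pow_ne_zero _ (by norm_num)⟩
  refine orderOf_eq_of_pow_and_pow_div_prime (by positivity) ?_ ?_
  · have := ZMod.pow_totient (ZMod.unitOfCoprime 2 (coprime_two_three_pow k))
    rw [Nat.totient_prime_pow Nat.prime_three (by omega : 0 < k + 1)] at this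
    simpa [mul_comm] using this
  · intro p hp hpd
    have hval : ∀ m : ℕ, (ZMod.unitOfCoprime 2 (coprime_two_three_pow k)) ^ m ≠ 1 ↔
        ((2 : ℕ) : ZMod (3 ^ (k + 1))) ^ m ≠ 1 := fun m => by
      rw [Ne, Ne, Units.ext_iff, Units.val_pow_eq_pow_val, ZMod.coe_unitOfCoprime, Units.val_one]
    rw [hval]
    -- `p = 2` or `p = 3`
    have hp23 : p = 2 ∨ p = 3 := by
      rcases (Nat.Prime.dvd_mul hp).1 hpd with h2 | h3
      · exact Or.inl ((Nat.prime_dvd_prime_iff_eq hp Nat.prime_two).1 h2)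
      · exact Or.inr ((Nat.prime_dvd_prime_iff_eq hp Nat.prime_three).1 (hp.dvd_of_dvd_pow h3))
    rcases hp23 with rfl | rfl
    · rw [Nat.mul_div_cancel_left _ (by norm_num)]
      exact two_pow_three_pow_ne_one k
    · rcases Nat.eq_zero_or_pos k with hk0 | hkpos
      · subst hk0
        simp only [pow_zero, mul_one] at hpd
        exact absurd (Nat.le_of_dvd (by norm_num) hpd) (by norm_num)
      · obtain ⟨j, rfl⟩ : ∃ j, k = j + 1 := ⟨k - 1, by omega⟩
        have e : 2 * 3 ^ (j + 1) / 3 = 2 * 3 ^ j := by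
          rw [pow_succ, ← mul_assoc, Nat.mul_div_cancel _ (by norm_num : 0 < 3)]
        rw [e]
        have := two_pow_two_mul_three_pow_ne_one (k := j + 1) (by omega)
        rwa [Nat.add_sub_cancel] at this

/-! ### Irreducibility and the field -/

/-- **`Φ_{3^{k+1}}` is irreducible over `𝔽₂`** (Lidl–Niederreiter Thm. 2.47(ii), Ex. 2.48). -/
theorem cubePoly_irreducible (k : ℕ) : Irreducible (cubePoly k) := by
  have h2 : ¬ 2 ∣ 3 ^ (k + 1) := by
    intro h; exact absurd (Nat.Prime.dvd_of_dvd_pow Nat.prime_two h) (by norm_num)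
  refine ZMod.irreducible_of_dvd_cyclotomic_of_natDegree (p := 2) h2 dvd_rfl ?_
  rw [natDegree_cubePoly]
  exact (orderOf_two_mod_three_pow k).symm

/-- `Φ_{3^{k+1}} = X^{2·3^k} + X^{3^k} + 1`. -/
theorem cubePoly_eq (k : ℕ) : cubePoly k = X ^ (2 * 3 ^ k) + X ^ 3 ^ k + 1 := by
  rw [cubePoly, Polynomial.cyclotomic_prime_pow_eq_geom_sum Nat.prime_three]
  simp only [Finset.sum_range_succ, Finset.sum_range_zero, zero_add, ← pow_mul]
  ring

/-- `𝔽₂[X]/(Φ_{3^{k+1}})` is a field (local instance material: `Fact (Irreducible (cubePoly k))`). -/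
theorem fact_irreducible_cubePoly (k : ℕ) : Fact (Irreducible (cubePoly k)) := ⟨cubePoly_irreducible k⟩

/-- **`|𝔽₂[X]/(Φ_{3^{k+1}})| = 2^{2·3^k}`** (for any finiteness structure; one is
`Fintype.ofEquiv _ (cubeEquiv k).symm.toEquiv`). -/
theorem card_cubeField (k : ℕ) [Fintype (AdjoinRoot (cubePoly k))] :
    Fintype.card (AdjoinRoot (cubePoly k)) = 2 ^ (2 * 3 ^ k) := by
  rw [Fintype.card_congr (cubeEquiv k).toEquiv]
  simp [ZMod.card]

end Summit.QuantumAdvantage.QuantumAdvantage.Theorems.SymplecticPurity
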